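import Summits.CriticalPhenomena.PercolationContinuityZ3.Theorems.Transplant.KNCells2Exit
import Summits.CriticalPhenomena.PercolationContinuityZ3.Theorems.Transplant.KNCells2Fail
import HarnessLib

/-!
# F8 (generic, LAG-1 ANCHORS), the node theorem — ONE statement for the instances: geometry + (32) at the root + the target lemma at the faces
# + the corridor lemma (plain Lemma 12 under `μ`) at the HISTORY ANCHORS ⟹ `SameP.SamePWitnessAt G root p`
# (supersedes `KNCellsWitness.samePWitnessAt_of_cellKit`, whose pattern-pinned corridor hypothesis was unsatisfiable — F8-DESIGN.md §7;
# re-filed under this name because the first submission `KNCells2Witness` is held by a gate lock; resubmitted 11:12Z)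

builds on p205010 (kernel theorem, internal audit signed; external expert review pending) — nothing in this file uses p205010.
Lane `prim-bschramm`, seat `prim-bschramm-p2`; helper file (`--supports stmt-CriticalPhenomena-4575`).

* **`samePWitnessAt_of_kit₂`** — `samePWitnessAt_of_cells₂` + `fail_bound₂`: for anchored scheme parameters `S` with face data `FD` on a
  countable locally finite `G`: `RunGeom`, `AnchGeom`, `SepGeom₂`, `ExitGeom`, `StepsGeom`, degree bound, envelope-region bound, `δc ≤ 1`,
  `4((1-δ₂)^K + ε') ≤ ε < 2⁻³²`, (32) at the root cell, and after every valid history, for every onward direction, at the history anchors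
  `(α, β) = (arr v, dep v)`: the face-prefix consequences `hP1`/`hP2` (discharged by a level geometry in `KNCells2FacePrefix`), the target lemma
  at the faces (`hface`) and `1 - ε' < P_{Wfull}(Reach)` (`hreach`, KN's Lemma 12 under `μ`) — give `SameP.SamePWitnessAt G root p`.
[cite: KozmaNitzan2024, §4 Theorem 6 (pp. 25–31) — the ℤ^d model] [cite: GrimmettPercolation1999, §7.2]
-/

noncomputable section

open MeasureTheory ProbabilityTheory
open scoped ENNReal Classical

namespace Summit.CriticalPhenomena.PercolationContinuityZ3.Theorems

namespace Transplant

namespace KNCells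

open Literature.Probability.Percolation Literature.Probability.LatticeModels SimpleGraph GadgetSystem ProbeHistory HSiteScheme Contour

variable {V : Type*} [DecidableEq V] [Countable V]

namespace KSchA

variable {A : Type*} {G : SimpleGraph V} [G.LocallyFinite] {S : KSchA V A} {FD : FaceData V A}

/-- **THE NODE OVER ANCHORED CELLS (lag-1 anchors).** [cite: KozmaNitzan2024, §4 Theorem 6 (pp. 25–31)] -/
theorem samePWitnessAt_of_kit₂ (hΓ : RunGeom G S.Γ) (hA : AnchGeom S.Γ) (hsep : SepGeom₂ G S.Γ) (hX : ExitGeom G S.Γ)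
    (hSt : StepsGeom S.Γ FD) {Δ B : ℕ} (hΔ : ∀ x, G.degree x ≤ Δ)
    (hB : ∀ (h : ProbeHistory V) (e : Site 2 × MDir) (a a' : A), (S.envRegion₂ G h e a a').card ≤ B)
    (hδc : S.δc ≤ 1) {ε ε' δ₂ : ℝ} (hε : ε < (1 / 2) ^ 32) (hε' : 0 ≤ ε') (hδ₂ : δ₂ ≤ 1)
    (hKε : 4 * ((1 - δ₂) ^ S.Γ.K + ε') ≤ ε)
    (hQ0 : ∀ du : MDir, 1 - S.δc < (prodBernoulli (pinW (KNLevels.lattW G S.p) ↑(S.U₀ G) ↑(S.U₀ G))).real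
      (⋃ t ∈ (↑(S.Γ.M S.Γ.a₀ ((0 : Site 2) + stepVec du)) : Set V),
        openConnIn (↑(S.Γ.Q S.Γ.a₀ 0 ∪ S.Γ.Ewv S.Γ.a₀ 0 du) : Set V) S.Γ.root t))
    (hP1 : ∀ h e, S.Valid₂ G h e → ∀ du ∈ S.onward G h (tgt e), ∀ ω,
      ω ∈ KNLevels.lattOnly G (S.Vx G h ∪ S.Γ.Ewv (S.aOf₁ G h e) e.1 e.2 ∪ FD.Hfull (S.aOf₂ G h e) (tgt e) du) →
      ω ∈ S.Reach G FD h e (S.aOf₁ G h e) (S.aOf₂ G h e) du → ω ∈ S.Aface G FD h e (S.aOf₁ G h e) (S.aOf₂ G h e) du (S.Γ.K - 1))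
    (hP2 : ∀ h e, S.Valid₂ G h e → ∀ du ∈ S.onward G h (tgt e), ∀ ω j, 1 ≤ j → j < S.Γ.K →
      ω ∈ KNLevels.lattOnly G (S.Vx G h ∪ S.Γ.Ewv (S.aOf₁ G h e) e.1 e.2 ∪ S.Γ.Stub (S.aOf₂ G h e) (tgt e) du (j + 1)) →
      ω ∈ S.Aface G FD h e (S.aOf₁ G h e) (S.aOf₂ G h e) du j → ω ∈ S.Aface G FD h e (S.aOf₁ G h e) (S.aOf₂ G h e) du (j - 1))
    (hface : ∀ h e, S.Valid₂ G h e → ∀ du ∈ S.onward G h (tgt e), ∀ j < S.Γ.K, ∀ o : Finset (Sym2 V),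
      1 - δ₂ < (prodBernoulli (S.Wt G h e (S.aOf₁ G h e) (S.aOf₂ G h e) du j o)).real
        (⋃ b ∈ FD.Face (S.aOf₂ G h e) (tgt e) du (j + 1), openConn S.Γ.root b) →
        S.cond G h e (S.aOf₁ G h e) (S.aOf₂ G h e) du j o)
    (hreach : ∀ h e, S.Valid₂ G h e → ∀ du ∈ S.onward G h (tgt e),
      1 - ε' < (prodBernoulli (S.Wfull G h e (S.aOf₁ G h e) (S.aOf₂ G h e) du)).real
        (S.Reach G FD h e (S.aOf₁ G h e) (S.aOf₂ G h e) du)) :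
    SameP.SamePWitnessAt G S.Γ.root S.p := by
  refine samePWitnessAt_of_cells₂ hΓ hA hsep hX hΔ hB hδc hε hQ0 fun h e hV => ?_
  exact (fail_bound₂ hV.anch hV hSt hε' hδ₂ (hP1 h e hV) (hP2 h e hV) (hface h e hV) (hreach h e hV)).trans hKε

end KSchA

end KNCells

end Transplant

end Summit.CriticalPhenomena.PercolationContinuityZ3.Theorems

end
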